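import Literature.NumberTheory.EllipticCurves.TianYuanZhang2017.UPlusOfGenusPointData
import HarnessLib

/-!
# Cell «bsd-monsky» (prover-B): `(θ − 1)A[4] ⊆ ℤ·τ(i/2)` for an automorphism with `θ(i) = −i`, `θ(√2) = √2` —
# PROOF-B's (T-c)/(θ2) as a KERNEL THEOREM (the finite computation on the sixteen `4`-torsion points of `A`)

HONEST FRAMING (cell `bsd-monsky`, run/shared/lean/pub/bsd-monsky/; README §1): pure algebra on TYZ's curve
`A : Y² = X³ + 4X` over an arbitrary field `H` of characteristic `0` containing `i` and `√2`; no number theory, nothing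
asserted about BSD. It discharges conjunct (θ2) of route B's display `thetaSpec`
(`P2/CongruentNumberSilentEvenFiveThetaDisplay.lean`) from the two class-field-theory values `θ(i) = −i`,
`θ(√2) = √2` of PROOF-B Lemma 4 (`θ|_{ℚ(ζ₈)} = r₂(7) = c`): for every `H`-point `t` of `A` with `4t = 0`,
`θ(t) − t ∈ ℤ·τ(i/2)` (`τ(i/2) = [i]τ(1/2) = (−2, 4i)`). PROOF-B (§2.2 (T-c), on `E`; on `A`: "(c−1)A[4] =
τ({x̄ − x}) = τ((i/2)ℤ) = ⟨τ(i/2)⟩") obtains it from the analytic parametrisation `τ`; here it is checked on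
coordinates WITHOUT a count of `A(H)[4]` (so TYZ Lemma 3.18 is not needed for this step): `2t ∈ A[2] =
{O, (0,0), (±2i, 0)}`; if `2t ∈ {O, (0,0)}` then `t` is one of the eight `ℚ(i)`-points `O, (0,0), (±2i,0), (2,±4),
(−2,±4i)` (= `A[(1+i)³]`, TYZ Lemma 3.16) on which `θ − 1` takes the values `0, ±2τ(i/2) (= τ(1))`; if
`2t = (2i, 0)` then `t = Q₀ + a` with `a ∈ A[2]` and the explicit point `Q₀ = (2i(1+√2), (1−i)(4+2√2))`
(`2Q₀ = (2i,0)`; tangent slope `−(1+√2)(1+i)`), and ONE chord computation gives `θQ₀ − Q₀ = (−2, −4i) = −τ(i/2)`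
(slope `i√2`); if `2t = (−2i, 0)` then `t = θQ₀ + a` and `(θ−1)(θQ₀) = Q₀ − θQ₀ = τ(i/2)` because `θ²` fixes the
coordinates of `Q₀` (they lie in `ℚ(i, √2)`). Used by `P2/CongruentNumberSilentEvenFiveThetaDescent.lean` to
replace (θ2) by `θ(√−2) = −√−2` in the hypothesis package `K_B`. Nothing booked; no mark moved.

References: HOME/proof/PROOF-B.md §2.2 (T-a)–(T-c), §7 Lemma 4 (θ1)–(θ2); [TianYuanZhang2017] §3.2 (τ, p0011
L121–L128, p0012 L1–L18), Lemma 3.16 (p0017 L98–L113), Lemma 3.17 (κ on A[4]); J. H. Silverman, AEC III.2.3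
(group law formulas).
-/

noncomputable section

open scoped Classical

open WeierstrassCurve WeierstrassCurve.Affine Literature.NumberTheory.EllipticCurves
  Literature.NumberTheory.EllipticCurves.TianYuanZhang2017

set_option autoImplicit false

namespace Summit.BirchSwinnertonDyer.Rank1Residual.P2.ThetaDescent

section FourTorsion

variable {H : Type} [Field H] [CharZero H]

/-! ## §1 The named points: `A[2] = {O, τ(1), T⁺, T⁻}` and the `4`-torsion point `Q₀` with `2Q₀ = T⁺` -/

/-- `T⁺ = (2i, 0) = τ((1−i)/2)`, a non-rational `2`-torsion point of `A : Y² = X³ + 4X`.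
[cite: TianYuanZhang2017, §3.2 (p0012 L12–L18)] -/
def tPlus (im : H) (him : im ^ 2 = -1) : APoint H :=
  .some (x := 2 * im) (y := 0) ((curveA_nonsingular_iff _ _).mpr (by linear_combination (-8 * im) * him))

/-- `T⁻ = (−2i, 0) = τ((1+i)/2)`, the other non-rational `2`-torsion point.
[cite: TianYuanZhang2017, §3.2 (p0012 L12–L18)] -/
def tMinus (im : H) (him : im ^ 2 = -1) : APoint H :=
  .some (x := -(2 * im)) (y := 0) ((curveA_nonsingular_iff _ _).mpr (by linear_combination (8 * im) * him))

/-- `Q₀ = (2i(1+√2), (1−i)(4+2√2))`, a point of `A[4] ∖ A[(1+i)³]` (`2Q₀ = T⁺`); its coordinates generate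
`ℚ(A[4]) = ℚ(i, √2)`. [cite: TianYuanZhang2017, Lemma 3.17 (p0017 L136–L149: A[4] and ζ₈)] -/
def qZero (im s : H) (him : im ^ 2 = -1) (hs : s ^ 2 = 2) : APoint H :=
  .some (x := 2 * im * (1 + s)) (y := (1 - im) * (4 + 2 * s)) ((curveA_nonsingular_iff _ _).mpr (by
    linear_combination (16 + 16 * s + 4 * s ^ 2 - 8 * im - 24 * im * s - 24 * im * s ^ 2 - 8 * im * s ^ 3) * him
      + (16 * im + 8 * im * s) * hs))

/-- **`A(H)[2] = {O, (0,0), (2i,0), (−2i,0)}`**: a point killed by `2` has `Y = 0` and `X(X² + 4) = 0`.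
[cite: TianYuanZhang2017, Lemma 3.16 (p0017 L98–L113)] -/
theorem eq_of_two_nsmul_eq_zero (im : H) (him : im ^ 2 = -1) (u : APoint H) (hu : (2 : ℕ) • u = 0) :
    u = 0 ∨ u = tauOne ∨ u = tPlus im him ∨ u = tMinus im him := by
  obtain ⟨h1, -, h3, -, -⟩ := curveA_baseChange_a (H := H)
  rcases u with _ | ⟨x, y, h⟩
  · exact Or.inl rfl
  · have heq : y ^ 2 = x ^ 3 + 4 * x := (curveA_nonsingular_iff x y).mp h
    have hnegY : (curveA.baseChange H).toAffine.negY x y = -y := by rw [negY, h1, h3]; ring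
    have hy : y = 0 := by
      by_contra hy0
      have hne : y ≠ (curveA.baseChange H).toAffine.negY x y := by
        rw [hnegY]; intro e; apply hy0; linear_combination e / 2
      rw [two_nsmul, Point.add_self_of_Y_ne hne] at hu
      exact Point.some_ne_zero _ hu
    subst hy
    have hx : x = 0 ∨ x = 2 * im ∨ x = -(2 * im) := by
      have h0' : x * (x - 2 * im) * (x + 2 * im) = 0 := by
        linear_combination (-1 : H) * heq + (-4 * x) * him
      rcases mul_eq_zero.mp h0' with h' | h'
      · rcases mul_eq_zero.mp h' with h'' | h''
        · exact Or.inl h''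
        · exact Or.inr (Or.inl (by linear_combination h''))
      · exact Or.inr (Or.inr (by linear_combination h'))
    rcases hx with rfl | rfl | rfl
    · exact Or.inr (Or.inl rfl)
    · exact Or.inr (Or.inr (Or.inl rfl))
    · exact Or.inr (Or.inr (Or.inr rfl))

/-- **`{t : 2t = τ(1)} = {±τ(1/2), ±τ(i/2)} = {(2, ±4), (−2, ±4i)}`** (the tangent condition `X(2t) = 0` forces
`X² = 4`). [cite: TianYuanZhang2017, Lemma 3.16 (p0017 L98–L113) and §3.2 (p0012 L12–L18)] -/
theorem eq_of_two_nsmul_eq_tauOne (im : H) (him : im ^ 2 = -1) (u : APoint H) (hu : (2 : ℕ) • u = tauOne) :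
    u = tauHalf ∨ u = -tauHalf ∨ u = cmI im him tauHalf ∨ u = -cmI im him tauHalf := by
  obtain ⟨h1, h2, h3, h4, -⟩ := curveA_baseChange_a (H := H)
  rcases u with _ | ⟨x, y, h⟩
  · exfalso
    rw [← Point.zero_def, smul_zero] at hu
    exact tauOne_ne_zero hu.symm
  · have heq : y ^ 2 = x ^ 3 + 4 * x := (curveA_nonsingular_iff x y).mp h
    have hnegY : (curveA.baseChange H).toAffine.negY x y = -y := by rw [negY, h1, h3]; ring
    have hne : y ≠ (curveA.baseChange H).toAffine.negY x y := by
      intro e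
      rw [two_nsmul, Point.add_of_Y_eq rfl e] at hu
      exact tauOne_ne_zero (H := H) hu.symm
    have hy0 : y ≠ 0 := by intro hy; apply hne; rw [hnegY, hy, neg_zero]
    rw [two_nsmul, Point.add_self_of_Y_ne hne, tauOne] at hu
    have hX := (Point.some.inj hu).1
    set L := (curveA.baseChange H).toAffine.slope x x y y with hL
    have hLdef : L = (3 * x ^ 2 + 4) / (2 * y) := by
      rw [hL, slope_of_Y_ne rfl hne, hnegY, h1, h2, h4]; ring
    have hX' : L ^ 2 = 2 * x := by
      rw [addX, h1, h2] at hX; linear_combination hX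
    have hmul : L * (2 * y) = 3 * x ^ 2 + 4 := by
      rw [hLdef, div_mul_cancel₀ _ (mul_ne_zero two_ne_zero hy0)]
    have hx2 : x ^ 2 = 4 := by
      have key : (x ^ 2 - 4) ^ 2 = 0 := by
        have e1 : (3 * x ^ 2 + 4) ^ 2 = L ^ 2 * (2 * y) ^ 2 := by rw [← hmul]; ring
        rw [hX'] at e1
        linear_combination e1 + 8 * x * heq
      have := (pow_eq_zero_iff (n := 2) (by norm_num)).mp key
      linear_combination this
    have hx : x = 2 ∨ x = -2 := by
      have e : (x - 2) * (x + 2) = 0 := by linear_combination hx2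
      rcases mul_eq_zero.mp e with h' | h'
      · left; linear_combination h'
      · right; linear_combination h'
    rcases hx with rfl | rfl
    · have hy : y = 4 ∨ y = -4 := by
        have e : (y - 4) * (y + 4) = 0 := by linear_combination heq
        rcases mul_eq_zero.mp e with h' | h'
        · left; linear_combination h'
        · right; linear_combination h'
      rcases hy with rfl | rfl
      · exact Or.inl rfl
      · refine Or.inr (Or.inl ?_)
        rw [tauHalf, Point.neg_some]
        simp only [Point.some.injEq, negY, h1, h3]
        norm_num
    · have hy : y = im * 4 ∨ y = -(im * 4) := by
        have e : (y - im * 4) * (y + im * 4) = 0 := by linear_combination heq - 16 * him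
        rcases mul_eq_zero.mp e with h' | h'
        · left; linear_combination h'
        · right; linear_combination h'
      rcases hy with rfl | rfl
      · refine Or.inr (Or.inr (Or.inl ?_))
        rw [tauHalf, cmI_some]
      · refine Or.inr (Or.inr (Or.inr ?_))
        rw [tauHalf, cmI_some, Point.neg_some]
        simp only [Point.some.injEq, negY, h1, h3]
        exact ⟨trivial, by ring⟩

/-- **`2Q₀ = T⁺ = (2i, 0)`** (tangent at `Q₀`: slope `(3X₀² + 4)/(2Y₀) = −(1+√2)(1+i)`, `X(2Q₀) = λ² − 2X₀ = 2i`,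
`Y(2Q₀) = 0`). [cite: TianYuanZhang2017, §3.2 (p0012 L12–L18)] -/
theorem two_nsmul_qZero (im s : H) (him : im ^ 2 = -1) (hs : s ^ 2 = 2) :
    (2 : ℕ) • qZero im s him hs = tPlus im him := by
  obtain ⟨h1, h2, h3, h4, -⟩ := curveA_baseChange_a (H := H)
  have him1 : (1 : H) - im ≠ 0 := by
    intro e
    have : im = 1 := by linear_combination -e
    rw [this] at him; norm_num at him
  have hs4 : (4 : H) + 2 * s ≠ 0 := by
    intro e
    have : s = -2 := by linear_combination e / 2
    rw [this] at hs; norm_num at hs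
  have hy0 : (1 - im) * (4 + 2 * s) ≠ 0 := mul_ne_zero him1 hs4
  have hne : (1 - im) * (4 + 2 * s) ≠ (curveA.baseChange H).toAffine.negY (2 * im * (1 + s)) ((1 - im) * (4 + 2 * s)) := by
    rw [negY, h1, h3]; intro e; apply hy0; linear_combination e / 2
  rw [two_nsmul, qZero, Point.add_self_of_Y_ne hne, tPlus]
  have hsl : (curveA.baseChange H).toAffine.slope (2 * im * (1 + s)) (2 * im * (1 + s)) ((1 - im) * (4 + 2 * s))
      ((1 - im) * (4 + 2 * s)) = -(1 + s) * (1 + im) := by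
    rw [slope_of_Y_ne rfl hne, negY, h1, h2, h3, h4,
      div_eq_iff (by intro e; apply hy0; linear_combination e / 2)]
    linear_combination (4 + 12 * s + 8 * s ^ 2) * him + (-4) * hs
  simp only [Point.some.injEq]
  refine ⟨?_, ?_⟩
  · rw [addX, hsl, h1, h2]
    linear_combination (1 + 2 * s + s ^ 2) * him + (2 * im) * hs
  · rw [addY, negAddY, addX, negY, hsl, h1, h2, h3]
    linear_combination (-3 - 3 * s + 3 * s ^ 2 + 3 * s ^ 3 + im + 3 * im * s + 3 * im * s ^ 2 + im * s ^ 3) * him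
      + (-2 * s + 2 * im * s) * hs

variable (θ : H →ₐ[ℚ] H)

/-- `θ(T⁺) = T⁻` and `θ(T⁻) = T⁺` when `θ(i) = −i`. [cite: TianYuanZhang2017, §3.2 (p0012 L12–L18)] -/
theorem map_tPlus_tMinus (im : H) (him : im ^ 2 = -1) (hθi : θ im = -im) :
    Point.map (W' := curveA) θ (tPlus im him) = tMinus im him ∧
      Point.map (W' := curveA) θ (tMinus im him) = tPlus im him := by
  constructor
  · rw [tPlus, Point.map_some, tMinus]
    simp only [map_mul, map_ofNat, map_zero, hθi, mul_neg]
  · rw [tMinus, Point.map_some, tPlus]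
    simp only [map_neg, map_mul, map_ofNat, map_zero, hθi, mul_neg, neg_neg]

/-- `T⁻ + T⁺ = τ(1)` (the three non-zero `2`-torsion points sum to zero). [cite: TianYuanZhang2017, Lemma 3.16 (p0017 L98–L113)] -/
theorem tMinus_add_tPlus (im : H) (him : im ^ 2 = -1) : tMinus im him + tPlus im him = tauOne := by
  obtain ⟨h1, h2, h3, -, -⟩ := curveA_baseChange_a (H := H)
  have him0 : im ≠ 0 := by rintro rfl; norm_num at him
  have hx : -(2 * im) ≠ 2 * im := by
    intro e; apply him0; linear_combination -e / 4
  rw [tMinus, tPlus, Point.add_of_X_ne hx, tauOne]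
  have hsl : (curveA.baseChange H).toAffine.slope (-(2 * im)) (2 * im) 0 0 = 0 := by
    rw [slope_of_X_ne hx]; simp
  simp only [Point.some.injEq]
  refine ⟨?_, ?_⟩
  · rw [addX, hsl, h1, h2]; ring
  · rw [addY, negAddY, addX, negY, hsl, h1, h2, h3]; ring

/-- `(θ − 1)T^± = τ(1) = 2τ(i/2)`. [cite: TianYuanZhang2017, Lemma 3.16 (p0017 L98–L113)] -/
theorem map_sub_tPlus_tMinus (im : H) (him : im ^ 2 = -1) (hθi : θ im = -im) :
    Point.map (W' := curveA) θ (tPlus im him) - tPlus im him = tauOne ∧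
      Point.map (W' := curveA) θ (tMinus im him) - tMinus im him = tauOne := by
  obtain ⟨hp, hm⟩ := map_tPlus_tMinus θ im him hθi
  have h2p : (2 : ℕ) • tPlus im him = 0 := by
    rw [two_nsmul, tPlus]; exact Point.add_of_Y_eq rfl (by simp [negY])
  have h2m : (2 : ℕ) • tMinus im him = 0 := by
    rw [two_nsmul, tMinus]; exact Point.add_of_Y_eq rfl (by simp [negY])
  have hnegp : -tPlus im him = tPlus im him := by
    rw [neg_eq_iff_add_eq_zero, ← two_nsmul, h2p]
  have hnegm : -tMinus im him = tMinus im him := by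
    rw [neg_eq_iff_add_eq_zero, ← two_nsmul, h2m]
  constructor
  · rw [hp, sub_eq_add_neg, hnegp, tMinus_add_tPlus]
  · rw [hm, sub_eq_add_neg, hnegm, add_comm, tMinus_add_tPlus]

/-- **The one chord: `θQ₀ − Q₀ = (−2, −4i) = −τ(i/2)`** (`θQ₀ = (−2i(1+√2), (1+i)(4+2√2))`, `−Q₀ =
(2i(1+√2), −(1−i)(4+2√2))`, chord slope `i√2`). [cite: TianYuanZhang2017, §3.2 (p0012 L12–L18)] -/
theorem map_qZero_sub (im s : H) (him : im ^ 2 = -1) (hs : s ^ 2 = 2) (hθi : θ im = -im) (hθs : θ s = s) :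
    Point.map (W' := curveA) θ (qZero im s him hs) - qZero im s him hs = -cmI im him tauHalf := by
  obtain ⟨h1, h2, h3, -, -⟩ := curveA_baseChange_a (H := H)
  have him0 : im ≠ 0 := by rintro rfl; norm_num at him
  have hs1 : (1 : H) + s ≠ 0 := by
    intro e
    have : s = -1 := by linear_combination e
    rw [this] at hs; norm_num at hs
  have hx : -(2 * im * (1 + s)) ≠ 2 * im * (1 + s) := by
    intro e
    have : 2 * im * (1 + s) = 0 := by linear_combination -e / 2
    exact mul_ne_zero (mul_ne_zero two_ne_zero him0) hs1 this
  have hθx : θ (2 * im * (1 + s)) = -(2 * im * (1 + s)) := by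
    simp only [map_mul, map_ofNat, map_add, map_one, hθi, hθs]; ring
  have hθy : θ ((1 - im) * (4 + 2 * s)) = (1 + im) * (4 + 2 * s) := by
    simp only [map_mul, map_sub, map_add, map_ofNat, map_one, hθi, hθs]; ring
  rw [qZero, Point.map_some, sub_eq_add_neg, Point.neg_some, tauHalf, cmI_some, Point.neg_some]
  simp only [hθx, hθy, negY, h1, h3, zero_mul, sub_zero]
  rw [Point.add_of_X_ne hx]
  have hsl : (curveA.baseChange H).toAffine.slope (-(2 * im * (1 + s))) (2 * im * (1 + s)) ((1 + im) * (4 + 2 * s))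
      (-((1 - im) * (4 + 2 * s))) = im * s := by
    rw [slope_of_X_ne hx, div_eq_iff (sub_ne_zero.mpr hx)]
    linear_combination (4 * s + 4 * s ^ 2) * him + (-4) * hs
  simp only [Point.some.injEq]
  refine ⟨?_, ?_⟩
  · rw [addX, hsl, h1, h2]
    linear_combination (s ^ 2) * him + (-1) * hs
  · rw [addY, negAddY, addX, hsl]
    simp only [negY, h1, h2, h3]
    linear_combination (-2 * s - 2 * s ^ 2 - im * s ^ 3) * him + (2 + im * s) * hs

/-- `θ(θQ₀) = Q₀`: the coordinates of `Q₀` lie in `ℚ(i, √2)`, on which `θ² = 1`. [cite: TianYuanZhang2017, Lemma 3.17 (p0017 L136–L149)] -/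
theorem map_map_qZero (im s : H) (him : im ^ 2 = -1) (hs : s ^ 2 = 2) (hθi : θ im = -im) (hθs : θ s = s) :
    Point.map (W' := curveA) θ (Point.map (W' := curveA) θ (qZero im s him hs)) = qZero im s him hs := by
  rw [qZero, Point.map_some, Point.map_some]
  simp only [map_mul, map_ofNat, map_add, map_sub, map_one, map_neg, hθi, hθs, neg_neg]

/-! ## §2 The theorem: `(θ − 1)t ∈ ℤ·τ(i/2)` for every `t` with `4t = 0` -/

/-- **PROOF-B (T-c)/(θ2) in the kernel.** Over a field `H ∋ i, √2` of characteristic `0`, for every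
`ℚ`-algebra endomorphism `θ` of `H` with `θ(i) = −i` and `θ(√2) = √2`, and every `H`-point `t` of `A : Y² = X³ + 4X`
with `4t = 0`: `θ(t) − t = k·τ(i/2)` for some `k ∈ ℤ` (`τ(i/2) = [i]τ(1/2) = (−2, 4i)`). Case analysis on
`2t ∈ A[2]`; one chord computation (`θQ₀ − Q₀ = −τ(i/2)`); no count of `A(H)[4]` used.
[cite: TianYuanZhang2017, Lemma 3.16 (p0017 L98–L113), Lemma 3.17 (p0017 L136–L149), §3.2 (p0012 L12–L18)] -/
theorem exists_map_sub_eq_zsmul_of_four_nsmul_eq_zero (im s : H) (him : im ^ 2 = -1) (hs : s ^ 2 = 2)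
    (hθi : θ im = -im) (hθs : θ s = s) (t : APoint H) (h4 : (4 : ℕ) • t = 0) :
    ∃ k : ℤ, Point.map (W' := curveA) θ t - t = k • cmI im him tauHalf := by
  have h22 : (2 : ℕ) • ((2 : ℕ) • t) = 0 := by rw [← mul_nsmul]; exact h4
  have hτ1 : Point.map (W' := curveA) θ tauOne = tauOne := by
    rw [tauOne, Point.map_some]; simp only [map_zero]
  have hτh : Point.map (W' := curveA) θ tauHalf = tauHalf := by
    rw [tauHalf, Point.map_some]; simp only [map_ofNat]
  have hτih : Point.map (W' := curveA) θ (cmI im him tauHalf) = -cmI im him tauHalf := by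
    rw [tauHalf, cmI_some, Point.map_some, Point.neg_some]
    obtain ⟨h1, -, h3, -, -⟩ := curveA_baseChange_a (H := H)
    simp only [Point.some.injEq, negY, h1, h3, map_neg, map_mul, map_ofNat, hθi]
    exact ⟨trivial, by ring⟩
  have h2τ : (2 : ℤ) • cmI im him (tauHalf : APoint H) = tauOne := by
    rw [two_zsmul, ← two_nsmul, two_nsmul_cmI_tauHalf]
  obtain ⟨hTp, hTm⟩ := map_sub_tPlus_tMinus θ im him hθi
  -- `(θ − 1)` on `A[2]`
  have hA2 : ∀ a : APoint H, (2 : ℕ) • a = 0 →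
      ∃ k : ℤ, Point.map (W' := curveA) θ a - a = k • cmI im him tauHalf := by
    intro a ha
    rcases eq_of_two_nsmul_eq_zero im him a ha with rfl | rfl | rfl | rfl
    · exact ⟨0, by rw [map_zero, sub_zero, zero_smul]⟩
    · exact ⟨0, by rw [hτ1, sub_self, zero_smul]⟩
    · exact ⟨2, by rw [hTp, h2τ]⟩
    · exact ⟨2, by rw [hTm, h2τ]⟩
  rcases eq_of_two_nsmul_eq_zero im him _ h22 with h0 | h0 | h0 | h0
  · exact hA2 t h0
  · -- `2t = τ(1)`: `t ∈ {±τ(1/2), ±τ(i/2)}`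
    rcases eq_of_two_nsmul_eq_tauOne im him t h0 with rfl | rfl | rfl | rfl
    · exact ⟨0, by rw [hτh, sub_self, zero_smul]⟩
    · exact ⟨0, by rw [map_neg, hτh, sub_self, zero_smul]⟩
    · exact ⟨-2, by rw [hτih, neg_smul, h2τ, ← two_nsmul_cmI_tauHalf im him, two_nsmul]; abel⟩
    · exact ⟨2, by rw [map_neg, hτih, neg_neg, h2τ, ← two_nsmul_cmI_tauHalf im him, two_nsmul]; abel⟩
  · -- `2t = T⁺ = 2Q₀`: `t = Q₀ + a`, `a ∈ A[2]`
    have ha : (2 : ℕ) • (t - qZero im s him hs) = 0 := by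
      rw [nsmul_sub, h0, two_nsmul_qZero, sub_self]
    obtain ⟨k, hk⟩ := hA2 _ ha
    refine ⟨k - 1, ?_⟩
    have e : Point.map (W' := curveA) θ t - t =
        (Point.map (W' := curveA) θ (t - qZero im s him hs) - (t - qZero im s him hs)) +
          (Point.map (W' := curveA) θ (qZero im s him hs) - qZero im s him hs) := by
      rw [map_sub]; abel
    rw [e, hk, map_qZero_sub θ im s him hs hθi hθs, sub_smul, one_smul]
    abel
  · -- `2t = T⁻ = 2θQ₀`: `t = θQ₀ + a`
    have h2θ : (2 : ℕ) • Point.map (W' := curveA) θ (qZero im s him hs) = tMinus im him := by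
      rw [← map_nsmul, two_nsmul_qZero, (map_tPlus_tMinus θ im him hθi).1]
    have ha : (2 : ℕ) • (t - Point.map (W' := curveA) θ (qZero im s him hs)) = 0 := by
      rw [nsmul_sub, h0, h2θ, sub_self]
    obtain ⟨k, hk⟩ := hA2 _ ha
    refine ⟨k + 1, ?_⟩
    have hθθ : Point.map (W' := curveA) θ (Point.map (W' := curveA) θ (qZero im s him hs)) -
        Point.map (W' := curveA) θ (qZero im s him hs) = cmI im him tauHalf := by
      rw [map_map_qZero θ im s him hs hθi hθs]
      have e := map_qZero_sub θ im s him hs hθi hθs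
      rw [sub_eq_iff_eq_add] at e
      rw [e]; abel
    have e : Point.map (W' := curveA) θ t - t =
        (Point.map (W' := curveA) θ (t - Point.map (W' := curveA) θ (qZero im s him hs)) -
            (t - Point.map (W' := curveA) θ (qZero im s him hs))) +
          (Point.map (W' := curveA) θ (Point.map (W' := curveA) θ (qZero im s him hs)) -
            Point.map (W' := curveA) θ (qZero im s him hs)) := by
      rw [map_sub]; abel
    rw [e, hk, hθθ, add_smul, one_smul]

end FourTorsion

end Summit.BirchSwinnertonDyer.Rank1Residual.P2.ThetaDescent

end
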